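import Literature.AlgebraicGeometry.Modules.VanishingLocusFiniteLocallyFree
import HarnessLib

/-!
# Intersections of vanishing loci: the closed subscheme where a FAMILY of morphisms into vector bundles vanishes

Topic `Literature/AlgebraicGeometry/Modules`; namespace `Literature.AlgebraicGeometry.Modules`.  THEOREMS ONLY (no definition, no named fact, no
instance, no notation, no `sorry`); universe-polymorphic.  Sequel of ★ `Modules/VanishingLocusOfHom` ∕ ★ `Modules/VanishingLocusFiniteLocallyFree`:
there, ONE morphism `u : 𝓔 ⟶ 𝓥` (`𝓔` quasi-coherent, `𝓥` finite locally free) has the vanishing locus `V(u) ↪ X`, the closed subscheme of the ideal sheaf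
`vanishingIdeal u`, representing `T ↦ {g : T ⟶ X | g^* u = 0}`.  Here: a FAMILY `u_k : 𝓔_k ⟶ 𝓥_k` (`k ∈ κ`, any index type) has the simultaneous vanishing
locus `V((u_k)_k) := ⋂_k V(u_k)`, the closed subscheme of the ideal sheaf `⨆_k vanishingIdeal (u_k)` (Mathlib's complete lattice `Scheme.IdealSheafData`),
representing `T ↦ {g | ∀ k, g^* u_k = 0}` ([Hartshorne1977] II Prop. 5.9 ∕ Ex. 3.11 (b): ideals add, closed subschemes intersect; [Fulton1998] B.3.4).

* `exists_comp_subschemeι_iff_le_ker` ∕ `existsUnique_comp_subschemeι_iff_le_ker` — the BRIDGE (Mathlib `Scheme.Hom.toImage`, `IdealSheafData.inclusion`,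
  `ker_subschemeι`): `g` factors (uniquely) through the closed subscheme of `I` iff `I ≤ ker g^♯`;
* `exists_comp_subschemeι_iSup_iff` — through the closed subscheme of `⨆_k I_k` iff through each `I_k` (`iSup_le_iff`);
* **`iSup_vanishingIdeal_le_ker_iff`**, **`exists_comp_subschemeι_iSup_vanishingIdeal_iff`**, `existsUnique_…` — `g` factors (uniquely) through
  `⋂_k V(u_k)` iff `g^* u_k = 0` for every `k`; `pullback_subschemeι_iSup_map_eq_zero` — every `u_k` dies on `⋂_k V(u_k)`.

Cell hodgecm-mathlib (FLOOR 0, P1 sub-line F-4 layer 2, (II-b) Hom-scheme, brick (b1) «sub-families inside a fixed closed subscheme form a CLOSED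
sub-functor», B-p20 (g14) census road (i′): `V := ⋂_{m ≥ e₀} V(α_m)`).  HC_CM is proved only modulo the 7 printed citations until rung 0 closes; this
file discharges none of them.

## References
* [Hartshorne1977] R. Hartshorne, *Algebraic Geometry* (1977), II Prop. 5.9 (PDF p. 146), II Ex. 3.11 (b) (p. 92).
* [Fulton1998] W. Fulton, *Intersection Theory*, 2nd ed. (1998), B.3.4 (PDF p. 410) (zero scheme of a section ∕ of a map of bundles).
-/

noncomputable section

universe u v

open CategoryTheory CategoryTheory.Limits AlgebraicGeometry TopologicalSpace Opposite

namespace Literature.AlgebraicGeometry.Modules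

open Literature.AlgebraicGeometry.Motives

variable {X T : Scheme.{u}} (g : T ⟶ X)

/-! ### The bridge: factoring through the closed subscheme of an ideal sheaf -/

/-- **`g : T ⟶ X` factors through the closed subscheme of the ideal sheaf `I` iff `I ≤ ker g^♯`** (Mathlib: `Scheme.Hom.toImage`,
`IdealSheafData.inclusion`; `ker` of the inclusion is `I`). [cite: Hartshorne1977, II Prop. 5.9 (PDF p. 146)] -/
theorem exists_comp_subschemeι_iff_le_ker (I : X.IdealSheafData) :
    (∃ g' : T ⟶ I.subscheme, g' ≫ I.subschemeι = g) ↔ I ≤ g.ker := by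
  constructor
  · rintro ⟨g', rfl⟩
    exact (Scheme.IdealSheafData.ker_subschemeι I).ge.trans (g'.le_ker_comp _)
  · intro h
    refine ⟨g.toImage ≫ Scheme.IdealSheafData.inclusion h, ?_⟩
    rw [Category.assoc, Scheme.IdealSheafData.inclusion_subschemeι]
    exact g.toImage_imageι

/-- **Unique factorisation** through the closed subscheme of `I` (a closed immersion is a monomorphism).
[cite: Hartshorne1977, II Prop. 5.9 (PDF p. 146)] -/
theorem existsUnique_comp_subschemeι_iff_le_ker (I : X.IdealSheafData) :
    (∃! g' : T ⟶ I.subscheme, g' ≫ I.subschemeι = g) ↔ I ≤ g.ker := by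
  rw [← exists_comp_subschemeι_iff_le_ker g I]
  refine ⟨fun h => h.exists, fun ⟨g', hg'⟩ => ⟨g', hg', fun g'' hg'' => ?_⟩⟩
  exact (cancel_mono I.subschemeι).mp (hg''.trans hg'.symm)

/-- **Intersections**: `g` factors through the closed subscheme of `⨆_k I_k` (the scheme-theoretic INTERSECTION of the closed subschemes of the
`I_k`) iff it factors through each of them. [cite: Hartshorne1977, II Ex. 3.11 (b) (p. 92)] -/
theorem exists_comp_subschemeι_iSup_iff {κ : Type v} (I : κ → X.IdealSheafData) :
    (∃ g' : T ⟶ (⨆ k, I k).subscheme, g' ≫ (⨆ k, I k).subschemeι = g) ↔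
      ∀ k, ∃ g' : T ⟶ (I k).subscheme, g' ≫ (I k).subschemeι = g := by
  rw [exists_comp_subschemeι_iff_le_ker, iSup_le_iff]
  exact forall_congr' fun k => (exists_comp_subschemeι_iff_le_ker g (I k)).symm

/-! ### The simultaneous vanishing locus of a family of morphisms into vector bundles -/

variable {κ : Type v} {E V : κ → X.Modules} (u : ∀ k, E k ⟶ V k)

/-- **`⨆_k vanishingIdeal (u_k) ≤ ker g^♯ ↔ ∀ k, g^* u_k = 0`** (`𝓔_k` quasi-coherent, `𝓥_k` finite locally free; ★ `vanishingIdeal_le_ker_iff'` termwise).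
[cite: Fulton1998, B.3.4 (PDF p. 410)] [cite: Hartshorne1977, II Prop. 5.9 (PDF p. 146)] -/
theorem iSup_vanishingIdeal_le_ker_iff [∀ k, (E k).IsQuasicoherent] (hV : ∀ k, IsFiniteLocallyFree (V k)) :
    (⨆ k, vanishingIdeal (u k)) ≤ g.ker ↔ ∀ k, (Scheme.Modules.pullback g).map (u k) = 0 := by
  rw [iSup_le_iff]
  exact forall_congr' fun k => vanishingIdeal_le_ker_iff' (g := g) (u := u k) (hV k)

/-- **`g` factors through the simultaneous vanishing locus `⋂_k V(u_k)` iff `g^* u_k = 0` for every `k`.**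
[cite: Fulton1998, B.3.4 (PDF p. 410)] [cite: Hartshorne1977, II Prop. 5.9 (PDF p. 146) and Ex. 3.11 (b) (p. 92)] -/
theorem exists_comp_subschemeι_iSup_vanishingIdeal_iff [∀ k, (E k).IsQuasicoherent] (hV : ∀ k, IsFiniteLocallyFree (V k)) :
    (∃ g' : T ⟶ (⨆ k, vanishingIdeal (u k)).subscheme, g' ≫ (⨆ k, vanishingIdeal (u k)).subschemeι = g) ↔
      ∀ k, (Scheme.Modules.pullback g).map (u k) = 0 := by
  rw [exists_comp_subschemeι_iff_le_ker, iSup_vanishingIdeal_le_ker_iff g u hV]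

/-- **`⋂_k V(u_k)` REPRESENTS `T ↦ {g : T ⟶ X | ∀ k, g^* u_k = 0}`** (unique factorisation).
[cite: Fulton1998, B.3.4 (PDF p. 410)] [cite: Hartshorne1977, II Prop. 5.9 (PDF p. 146)] -/
theorem existsUnique_comp_subschemeι_iSup_vanishingIdeal_iff [∀ k, (E k).IsQuasicoherent]
    (hV : ∀ k, IsFiniteLocallyFree (V k)) :
    (∃! g' : T ⟶ (⨆ k, vanishingIdeal (u k)).subscheme, g' ≫ (⨆ k, vanishingIdeal (u k)).subschemeι = g) ↔
      ∀ k, (Scheme.Modules.pullback g).map (u k) = 0 := by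
  rw [existsUnique_comp_subschemeι_iff_le_ker, iSup_vanishingIdeal_le_ker_iff g u hV]

/-- **Every `u_k` dies on `⋂_k V(u_k)`.** [cite: Fulton1998, B.3.4 (PDF p. 410)] -/
theorem pullback_subschemeι_iSup_map_eq_zero [∀ k, (E k).IsQuasicoherent] (hV : ∀ k, IsFiniteLocallyFree (V k)) (k : κ) :
    (Scheme.Modules.pullback (⨆ k, vanishingIdeal (u k)).subschemeι).map (u k) = 0 :=
  (exists_comp_subschemeι_iSup_vanishingIdeal_iff (⨆ k, vanishingIdeal (u k)).subschemeι u hV).mp ⟨𝟙 _, Category.id_comp _⟩ k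

/-- The simultaneous vanishing locus contains — i.e. its ideal is below that of — nothing smaller than each `V(u_k)`: `vanishingIdeal (u_k) ≤ ⨆`.
(Order bookkeeping for consumers.) [cite: Hartshorne1977, II Ex. 3.11 (b) (p. 92)] -/
theorem vanishingIdeal_le_iSup (k : κ) : vanishingIdeal (u k) ≤ ⨆ k, vanishingIdeal (u k) :=
  le_iSup (fun k => vanishingIdeal (u k)) k

end Literature.AlgebraicGeometry.Modules

end
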